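import Literature.Analysis.FluidPDE.CaloricDuhamelRepresentation
import HarnessLib

/-!
# Duality terms: from `∫ f · X` to `∫ g̃ · (Ǩ ⋆ f)` with a continuous potential

Analysis/FluidPDE support file for the discharge of the named fact
`Literature.Analysis.FluidPDE.NSBoundedInteriorContinuity` (`NSBoundedInteriorRegularity.lean`;
Seregin–Šverák 2009, §2). Each term of the master identity
(`NSBoundedCaloricDuality.integral_cutoff_mul_test_mul_inner_eq`) is `∫ f · X` with a data
function `f` (cut-off × monomial in `u` or the pressure) and a caloric field `X` which, where `f`
does not vanish, is the space–time convolution `K ⋆ g̃` of the test function with a backward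
kernel (`CaloricDuhamelRepresentation`). This file performs, once and for all, the passage
`∫ f · X = ∫ g̃ · (Ǩ ⋆ f)` (the adjoint identity of `CaloricPotentialContinuity`) together with
the continuity of the potential `Ǩ ⋆ f`, in the two situations that occur:

* `duality_term_sliceBound` — slice-bound kernels and bounded data with bounded time support:
  `Ǩ ⋆ f` is continuous everywhere;
* `duality_term_offDiag` — kernels bounded off the diagonal `{δ ≤ ‖y‖}` and integrable data
  supported in `ℝ × A`, with the test function supported in `ℝ × A_g` and `A`, `A_g`
  `δ`-separated: `Ǩ ⋆ f` is continuous on every open set `U` whose points are `δ`-separated from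
  `A` (and `IsOffDiagKernel.of_univ` for kernels bounded everywhere).

All statements are proved; `E` is any finite-dimensional real inner product space.
-/

noncomputable section

open MeasureTheory Set Function Filter TopologicalSpace Metric ContinuousLinearMap
open scoped Topology RealInnerProductSpace ENNReal Convolution

namespace Literature.Analysis.FluidPDE

variable {E : Type*} [NormedAddCommGroup E] [InnerProductSpace ℝ E] [FiniteDimensional ℝ E]
  [MeasurableSpace E] [BorelSpace E]

/-- A space–time test function is integrable and has a time support. [folklore] -/
theorem IsSpaceTimeTestOn.integrable_uncurry {g : ℝ → E → ℝ}
    (hg : IsSpaceTimeTestOn (⊤ : Opens (ℝ × E)) g) : Integrable (uncurry g) (volume : Measure (ℝ × E)) :=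
  hg.contDiff.continuous.integrable_of_hasCompactSupport hg.hasCompactSupport

/-- **Duality term, slice-bound kernel.** Let `K = backKernel κ` be slice-bound, `g` a
space–time test function, `f` bounded measurable integrable data with time support in `[a, b]`,
and `X` a field with `X = K ⋆ g̃` wherever `f ≠ 0`. Then `∫ f X = ∫ g̃ (Ǩ ⋆ f)` and the potential
`Ǩ ⋆ f` (`Ǩ(v) = K(-v)`) is continuous. [folklore] -/
theorem duality_term_sliceBound {κ : ℝ → E → ℝ} {N : ℝ → ℝ} (hK : IsSliceBoundKernel (backKernel κ) N)
    {g : ℝ → E → ℝ} (hg : IsSpaceTimeTestOn (⊤ : Opens (ℝ × E)) g) {f X : ℝ × E → ℝ}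
    (hX : ∀ z, f z ≠ 0 → X z = (backKernel κ ⋆[lsmul ℝ ℝ, (volume : Measure (ℝ × E))] uncurry g) z)
    (hfi : Integrable f volume) {M : ℝ} (hM : 0 ≤ M)
    (hfM : ∀ᵐ z ∂(volume : Measure (ℝ × E)), |f z| ≤ M) {a b : ℝ}
    (hfsupp : ∀ᵐ z ∂(volume : Measure (ℝ × E)), f z ≠ 0 → z.1 ∈ Icc a b) :
    (∫ z, f z * X z =
      ∫ z, uncurry g z * ((fun v => backKernel κ (-v)) ⋆[lsmul ℝ ℝ, (volume : Measure (ℝ × E))] f) z) ∧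
    Continuous ((fun v => backKernel κ (-v)) ⋆[lsmul ℝ ℝ, (volume : Measure (ℝ × E))] f) := by
  obtain ⟨a', b', hab'⟩ := hg.exists_time_support
  have hgi := hg.integrable_uncurry
  have hgsupp : ∀ w : ℝ × E, uncurry g w ≠ 0 → w.1 ∈ Icc a' b' := fun w hw => by
    by_contra h
    exact hw (by simp only [uncurry]; rw [hab' w.1 h]; rfl)
  refine ⟨?_, hK.reflect.continuous_convolution hfi hM hfM hfsupp |>.congr ?_⟩
  · have h1 : ∫ z, f z * X z =
        ∫ z, f z * (backKernel κ ⋆[lsmul ℝ ℝ, (volume : Measure (ℝ × E))] uncurry g) z := by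
      refine integral_congr_ae (Eventually.of_forall fun z => ?_)
      by_cases hz : f z = 0
      · simp [hz]
      · simp only [hX z hz]
    rw [h1]
    exact integral_mul_convolution_comm
      (hK.integrable_kernelPairing hfi.aestronglyMeasurable hM hfM hfsupp hgi hgsupp)
  · intro z; rfl

omit [InnerProductSpace ℝ E] [FiniteDimensional ℝ E] [BorelSpace E] in
/-- A kernel bounded and continuous (off `τ = 0`) everywhere is off-diagonal on every `D`.
[folklore] -/
theorem IsOffDiagKernel.of_univ {K : ℝ × E → ℝ} (hK : IsOffDiagKernel K univ) (D : Set E) :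
    IsOffDiagKernel K D where
  measurable := hK.measurable
  bdd := by obtain ⟨B, hB⟩ := hK.bdd; exact ⟨B, fun τ y _ => hB τ y (mem_univ _)⟩
  continuousAt τ hτ y _ := hK.continuousAt τ hτ y (mem_univ _)

/-- **Duality term, off-diagonal kernel.** Let `K = backKernel κ` be bounded off the diagonal
`{δ ≤ ‖y‖}`, `g` a space–time test function spatially supported in `A_g`, `f` integrable data
supported in `ℝ × A` with `A` and `A_g` `δ`-separated, and `X = K ⋆ g̃` wherever `f ≠ 0`. Then
`∫ f X = ∫ g̃ (Ǩ ⋆ f)`, and `Ǩ ⋆ f` is continuous on every open `U` whose points are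
`δ`-separated from `A` in space. [folklore] -/
theorem duality_term_offDiag {κ : ℝ → E → ℝ} {δ : ℝ}
    (hK : IsOffDiagKernel (backKernel κ) {y | δ ≤ ‖y‖})
    {g : ℝ → E → ℝ} (hg : IsSpaceTimeTestOn (⊤ : Opens (ℝ × E)) g) {A Ag : Set E}
    (hgA : ∀ t y, g t y ≠ 0 → y ∈ Ag) (hsep : ∀ a ∈ A, ∀ a' ∈ Ag, δ ≤ ‖a - a'‖)
    {f X : ℝ × E → ℝ}
    (hX : ∀ z, f z ≠ 0 → X z = (backKernel κ ⋆[lsmul ℝ ℝ, (volume : Measure (ℝ × E))] uncurry g) z)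
    (hfi : Integrable f volume) (hfA : ∀ᵐ z ∂(volume : Measure (ℝ × E)), f z ≠ 0 → z.2 ∈ A)
    {U : Set (ℝ × E)} (hU : IsOpen U) (hUA : ∀ z ∈ U, ∀ a ∈ A, δ ≤ ‖z.2 - a‖) :
    (∫ z, f z * X z =
      ∫ z, uncurry g z * ((fun v => backKernel κ (-v)) ⋆[lsmul ℝ ℝ, (volume : Measure (ℝ × E))] f) z) ∧
    ContinuousOn ((fun v => backKernel κ (-v)) ⋆[lsmul ℝ ℝ, (volume : Measure (ℝ × E))] f) U := by
  have hgi := hg.integrable_uncurry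
  have hD : ∀ y ∈ {y : E | δ ≤ ‖y‖}, -y ∈ {y : E | δ ≤ ‖y‖} := fun y hy => by simpa using hy
  refine ⟨?_, hK.reflect hD |>.continuousOn_convolution hfi hfA hU fun z hz a ha => hUA z hz a ha⟩
  have h1 : ∫ z, f z * X z =
      ∫ z, f z * (backKernel κ ⋆[lsmul ℝ ℝ, (volume : Measure (ℝ × E))] uncurry g) z := by
    refine integral_congr_ae (Eventually.of_forall fun z => ?_)
    by_cases hz : f z = 0
    · simp [hz]
    · simp only [hX z hz]
  rw [h1]
  refine integral_mul_convolution_comm (hK.integrable_kernelPairing hfi hfA hgi fun w hw a ha => ?_)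
  exact hsep a ha w.2 (hgA w.1 w.2 hw)

end Literature.Analysis.FluidPDE
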